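import Mathlib
import HarnessLib
import Summits.HubbardSuperconductivity.HubbardSuperconductivity.Theorems.KLProgrammeKLRegimeEngineTwoLegStepV17F2ZeroCloserGQJ
import Summits.HubbardSuperconductivity.HubbardSuperconductivity.Theorems.KLProgrammeKLRegimeEngineV8Raise
import Summits.HubbardSuperconductivity.HubbardSuperconductivity.Theorems.KLProgrammeKLRegimeEngineV8DefsQ8
import Summits.HubbardSuperconductivity.HubbardSuperconductivity.Theorems.KLProgrammeKLRegimeEngineV8DefsU10
import Summits.HubbardSuperconductivity.HubbardSuperconductivity.Theorems.KLProgrammeKLRegimeEngineV8DefsL4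
import Summits.HubbardSuperconductivity.HubbardSuperconductivity.Theorems.KLProgrammeKLRegimeEngineV8DefsG8
import Summits.HubbardSuperconductivity.HubbardSuperconductivity.Theorems.KLProgrammeKLRegimeTwoLegCurvatureConstsJetC2

/-!
# Stub (M) `stub_twoLeg_scale0` — RAISE-GENERIC closer at the v2 token layer (plan g19 (R57b)(ii) advisory; (R55.14) v2-(M) re-closer under EVERY table)
# (cell gate-hubbard-kl, seat p1b g10 — (M) owner lineage, 20437 registrant lineage)

The v2 engine-package token #13 is `klEngQ9 P R := ((klEngQ8 P R).withCR …).withCE e_T` (K7(b)), a RAISE of `klEngQ7 P R` (`EngConsts.IsRaiseOf`: `CR`, `CE` weakly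
raised, every other row pinned — …EngineV8Raise, p551175) whose body (`e_T`) is fixed only by E1's 08-29 word.  The (M) chain reads the package `Q` ONLY through
the pinned rows `Q.S'`, `Q.CL`, `Q.M0` (…ZeroCloserGQJ, p548140: `stub_twoLeg_scale0_GQJ`), so (M) closes at EVERY raise of `klEngQ7 P R` by the SAME term:

* **`stub_twoLeg_scale0_raise`** — for every `Q` with `(klEngQ7 P R).IsRaiseOf Q` and every absolute jet table `cJ ≤ klEngGeo8.S`: the v2 (M) binder list at
  (`klEngGeo8`, `Q`, `klEngC₃6 P R`, door `U ≤ klEngU₀10 P R c`, `klEngL₄ P R β U ≤ L`) ⟹ `TwoLegStepV17F2 L M klEngGeo8 P Q R β U μ 0`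
  (rows by `IsRaiseOf.S'_eq / CL_eq / M0_eq` down to `klC4aJetC'_le_klEngQ6_S'`, `klEngQ6_CL_nonneg`, `four_le_klEngQ6_CL_zero`, `rfl`).
* **`stub_twoLeg_scale0_raise_jetC2`** — the same at the v2 table `cJ := klC4aJetC2` (token #9′; `klC4aJetC2_le_klEngGeo8_S`, c4a-1).
* (sanity, not restated here: at `Q := klEngQ8 P R`, `isRaiseOf_klEngQ8`, the term reproduces the landed `stub_twoLeg_scale0_klEng8Q8U10L4`, p549371 — dedup.)

v2 DAY ((R55.14), whatever `e_T`): `theorem stub_twoLeg_scale0 : <v2 (M) text> := fun P R c hP hR hc hc3 μ hμ U hU hUle β hβ hβc L M _ _ hL hM hfr hE hJ =>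
stub_twoLeg_scale0_raise_jetC2 P R (klEngQ9 P R) (isRaiseOf_klEngQ9 P R) c hP hR hc hc3 μ hμ U hU (hUle.trans (klEngU₀11_le_klEngU₀10 P R c)) β hβ hβc L M hL hM hfr hE hJ`.

Proof only; no definition; nothing asserts superconductivity.  References: BGM 2006 §2–§3 [cite: BenfattoGiulianiMastropietro2006].
-/

noncomputable section

namespace Summit.HubbardSuperconductivity.HubbardSuperconductivity.Theorems.EngineV8

set_option linter.dupNamespace false -- summit = problem name (single-conjunct summit), D-0017

open Real Finset Literature.MathematicalPhysics.QuantumLattice Literature.Probability.LatticeModels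
open Literature.MathematicalPhysics.QuantumLattice.FermiRG Literature.MathematicalPhysics.QuantumLattice.BandSectorCounting
open Summit.HubbardSuperconductivity.HubbardSuperconductivity.Theorems.KLProgrammeLegKernels
open Summit.HubbardSuperconductivity.HubbardSuperconductivity.Theorems.DispersionFlow
open Summit.HubbardSuperconductivity.HubbardSuperconductivity.Theorems.PerturbedFermiCurve
open Summit.HubbardSuperconductivity.HubbardSuperconductivity.Theorems.KLRegimeSplit
open Summit.HubbardSuperconductivity.HubbardSuperconductivity.Theorems.TwoVolumeDefect

/-- **STUB (M), RAISE-GENERIC at the v2 token layer**: for every raise `Q` of `klEngQ7 P R` and every absolute jet table `cJ ≤ klEngGeo8.S`, the v2 (M) binders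
(`klEngC₃6`, door `klEngU₀10`, `klEngL₄`, `klEngM₃`; frame `K_0`, engine bounds at `(klEngGeo8, Q)`, jet bound at `(cJ, klC4aJetC' P R)`) give
`TwoLegStepV17F2 L M klEngGeo8 P Q R β U μ 0`. -/
theorem stub_twoLeg_scale0_raise (P : SplitConsts) (R : RenConsts) (Q : EngConsts) (hQ : (klEngQ7 P R).IsRaiseOf Q) (cJ : ℕ → ℝ)
    (hGS : ∀ k, cJ k ≤ klEngGeo8.S k) (c : ℝ) (hP : P.WF) (hR : R.WF2) (hc : 0 < c) (hc3 : c ≤ klEngC₃6 P R) (μ : ℝ) (hμ : μ ∈ klWindowC) (U : ℝ)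
    (hU : 0 < U) (hUle : U ≤ klEngU₀10 P R c) (β : ℝ) (hβ : klBetaMin ≤ β) (hβc : β ≤ Real.exp (c / U ^ 2)) (L M : ℕ) [NeZero L] [NeZero M]
    (hL : klEngL₄ P R β U ≤ L) (hM : klEngM₃ β U L ≤ M) (hfr : FrameOK R U (nScales β) μ (klFlowFrameU L M β U μ 0))
    (hE : EngineBoundsAtV17F2 L M klEngGeo8 P Q β U μ 0) (hJ : TwoLegReadJetBound L M cJ (klC4aJetC' P R) β U μ (klFlowFrameU L M β U μ 0) 0) :
    TwoLegStepV17F2 L M klEngGeo8 P Q R β U μ 0 :=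
  stub_twoLeg_scale0_GQJ klEngGeo8 Q cJ (klC4aJetC' P R) P R c hGS
    (fun k => by rw [hQ.S'_eq, klEngQ7_S']; exact klC4aJetC'_le_klEngQ6_S' P R k)
    (fun β n => by rw [hQ.CL_eq, klEngQ7_CL]; exact klEngQ6_CL_nonneg P R β n)
    (fun β => by rw [hQ.CL_eq, klEngQ7_CL]; exact four_le_klEngQ6_CL_zero P R β)
    (fun β U L => by rw [hQ.M0_eq]; exact le_of_eq rfl)
    (klEngC₃6_le_klEngC₃3 P R) (klEngU₀10_le_klEngU₀9 P R c) hP hR hc hc3 μ hμ U hU hUle β hβ hβc L M (klEngL₃_le_of_klEngL₄_le hL) hM hfr hE hJ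

/-- **STUB (M), RAISE-GENERIC, at the v2 jet table `klC4aJetC2`** (token #9′): the v2-day (M) re-closer's body under EVERY table
(`Q := klEngQ9 P R`, `hQ := isRaiseOf_klEngQ9 P R`, door via `klEngU₀11_le_klEngU₀10`). -/
theorem stub_twoLeg_scale0_raise_jetC2 (P : SplitConsts) (R : RenConsts) (Q : EngConsts) (hQ : (klEngQ7 P R).IsRaiseOf Q) (c : ℝ) (hP : P.WF)
    (hR : R.WF2) (hc : 0 < c) (hc3 : c ≤ klEngC₃6 P R) (μ : ℝ) (hμ : μ ∈ klWindowC) (U : ℝ) (hU : 0 < U) (hUle : U ≤ klEngU₀10 P R c) (β : ℝ)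
    (hβ : klBetaMin ≤ β) (hβc : β ≤ Real.exp (c / U ^ 2)) (L M : ℕ) [NeZero L] [NeZero M] (hL : klEngL₄ P R β U ≤ L) (hM : klEngM₃ β U L ≤ M)
    (hfr : FrameOK R U (nScales β) μ (klFlowFrameU L M β U μ 0)) (hE : EngineBoundsAtV17F2 L M klEngGeo8 P Q β U μ 0)
    (hJ : TwoLegReadJetBound L M klC4aJetC2 (klC4aJetC' P R) β U μ (klFlowFrameU L M β U μ 0) 0) :
    TwoLegStepV17F2 L M klEngGeo8 P Q R β U μ 0 :=
  stub_twoLeg_scale0_raise P R Q hQ klC4aJetC2 klC4aJetC2_le_klEngGeo8_S c hP hR hc hc3 μ hμ U hU hUle β hβ hβc L M hL hM hfr hE hJ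

/-- **STUB (M), RAISE-GENERIC IN BOTH PACKAGES** (appended 2026-08-27, p1b g10; plan g19 (R59g)/(R59h)(ii)(d) contingent token #22): for ANY geometry package `G`
— the (M) chain reads `G` only through its jet table `G.S` (`hGS : cJ ≤ G.S`; `stub_twoLeg_scale0_GQJ` is `G`-generic) — and any raise `Q` of `klEngQ7 P R`, the v2
(M) binders at `(G, Q)` give `TwoLegStepV17F2 L M G P Q R β U μ 0`.  Under #22 (`klEngGeo9 P R := klEngGeo8.raiseCF …`, a `CF`-only raise): `G := klEngGeo9 P R`,
`hGS k := by rw [raiseCF_S]; exact klC4aJetC2_le_klEngGeo8_S k` — an `rfl` row, nothing reads `CF`. -/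
theorem stub_twoLeg_scale0_raise_G (G : GeoConsts) (P : SplitConsts) (R : RenConsts) (Q : EngConsts) (hQ : (klEngQ7 P R).IsRaiseOf Q) (cJ : ℕ → ℝ)
    (hGS : ∀ k, cJ k ≤ G.S k) (c : ℝ) (hP : P.WF) (hR : R.WF2) (hc : 0 < c) (hc3 : c ≤ klEngC₃6 P R) (μ : ℝ) (hμ : μ ∈ klWindowC) (U : ℝ)
    (hU : 0 < U) (hUle : U ≤ klEngU₀10 P R c) (β : ℝ) (hβ : klBetaMin ≤ β) (hβc : β ≤ Real.exp (c / U ^ 2)) (L M : ℕ) [NeZero L] [NeZero M]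
    (hL : klEngL₄ P R β U ≤ L) (hM : klEngM₃ β U L ≤ M) (hfr : FrameOK R U (nScales β) μ (klFlowFrameU L M β U μ 0))
    (hE : EngineBoundsAtV17F2 L M G P Q β U μ 0) (hJ : TwoLegReadJetBound L M cJ (klC4aJetC' P R) β U μ (klFlowFrameU L M β U μ 0) 0) :
    TwoLegStepV17F2 L M G P Q R β U μ 0 :=
  stub_twoLeg_scale0_GQJ G Q cJ (klC4aJetC' P R) P R c hGS
    (fun k => by rw [hQ.S'_eq, klEngQ7_S']; exact klC4aJetC'_le_klEngQ6_S' P R k)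
    (fun β n => by rw [hQ.CL_eq, klEngQ7_CL]; exact klEngQ6_CL_nonneg P R β n)
    (fun β => by rw [hQ.CL_eq, klEngQ7_CL]; exact four_le_klEngQ6_CL_zero P R β)
    (fun β U L => by rw [hQ.M0_eq]; exact le_of_eq rfl)
    (klEngC₃6_le_klEngC₃3 P R) (klEngU₀10_le_klEngU₀9 P R c) hP hR hc hc3 μ hμ U hU hUle β hβ hβc L M (klEngL₃_le_of_klEngL₄_le hL) hM hfr hE hJ

end Summit.HubbardSuperconductivity.HubbardSuperconductivity.Theorems.EngineV8

end
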